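import Mathlib
import Literature.Computability.Complexity.RangeAvoidance
import Literature.Computability.Complexity.SignDegreeXor
import Summits.PneNP.PneNP.Theorems.PstarPDT
import Summits.PneNP.PneNP.Theorems.PstarSALevel
import Summits.PneNP.PneNP.Theorems.PstarTyped
import Summits.PneNP.PneNP.Theorems.PstarGapPeeling
import Summits.PneNP.PneNP.Theorems.PstarCentreFree
import Summits.PneNP.PneNP.Theorems.PstarGapOneAndRepair

/-!
# One AND-parity: the three endgames (ROUND-24 item T24.16, part II)

FRONTIER range-avoidance ladder, rung F-N3, ROUND 24 (cell `pnp-ideate`; restricted-model proof complexity — nothing here bears on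
`P` versus `NP`).  Continues `PstarGapOneAndRepair`; consumed by `PstarGapOneAnd`.

With `J` infeasible under the single AND-type parity constraint and `z` a solution of all outputs of `J`, each of the following
configurations yields a solution WITH the prescribed parity (via `PstarGapOneAndRepair.repair`), a contradiction:
* `endgame_all` (E1): an XOR-slot variable `u` all of whose readers in `J` are chords carrying a constrained variable — flip `u`;
  every reader was at `(1,1)` (`chord_true`) and now wants product `0`.
* `endgame_leaf` (E2): an XOR slot `u` of an output `f` that has a `J`-private AND variable (leaf) whose partner is `true` in `z`, all
  other readers of `u` being such chords (and at least one) — flip `u` and the leaf.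
* `endgame_double` (E3): the two XOR variables of `f` are read otherwise only by such chords, none reading both, at least one reading
  one — flip both (the XOR side of `f` is unchanged).
-/

set_option linter.dupNamespace false -- `Summit.PneNP.PneNP.…`: summit = sub-problem name (D-0017 single-conjunct layout)

open Finset Literature.Computability.Complexity
open Summit.PneNP.PneNP.Theorems.PstarPDT (parity)
open Summit.PneNP.PneNP.Theorems.PstarTyped (Typed)
open Summit.PneNP.PneNP.Theorems.PstarSALevel (varSet bdry)
open Summit.PneNP.PneNP.Theorems.PstarGapPeeling (eval_congr not_mem_varSet_of_private eval_update_of_not_mem eval_pure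
  eval_update_xor_slot)
open Summit.PneNP.PneNP.Theorems.PstarCentreFree (vars_mem_varSet)
open Summit.PneNP.PneNP.Theorems.PstarGapOneAndRepair

namespace Summit.PneNP.PneNP.Theorems.PstarGapOneAndEndgames

variable {n m : ℕ}

/-! ## Two computations -/

/-- Flipping one XOR-slot variable of `g` toggles its XOR part. -/
theorem xor_part_flip (I : LocalMap 4 n m) (hI : I.IsPure xorAndPred) (z : Fin n → Bool) {g : Fin m} {u : Fin n}
    (hu : I.vars g 0 = u ∨ I.vars g 1 = u) :
    xor (Function.update z u (!z u) (I.vars g 0)) (Function.update z u (!z u) (I.vars g 1)) =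
      !xor (z (I.vars g 0)) (z (I.vars g 1)) := by
  have h01 : I.vars g 0 ≠ I.vars g 1 := fun h => absurd (hI.2 g h) (by decide)
  rcases hu with rfl | rfl
  · rw [Function.update_self, Function.update_of_ne h01.symm]
    cases z (I.vars g 0) <;> cases z (I.vars g 1) <;> rfl
  · rw [Function.update_self, Function.update_of_ne h01]
    cases z (I.vars g 0) <;> cases z (I.vars g 1) <;> rfl

/-- The XOR part of a correct output at `(1,1)` is the negated target. -/
theorem xor_part_of_chord (I : LocalMap 4 n m) (hI : I.IsPure xorAndPred) {y : Fin m → Bool} {z : Fin n → Bool} {g : Fin m}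
    (hzg : I.eval z g = y g) (h2 : z (I.vars g 2) = true) (h3 : z (I.vars g 3) = true) :
    xor (z (I.vars g 0)) (z (I.vars g 1)) = !y g := by
  rw [eval_pure I hI, h2, h3] at hzg
  revert hzg
  cases z (I.vars g 0) <;> cases z (I.vars g 1) <;> cases y g <;> simp

/-! ## The endgames -/

section Endgames

variable (I : LocalMap 4 n m) (hI : I.IsPure xorAndPred) (hT : Typed I) (y : Fin m → Bool) (J : Finset (Fin m))
  (C : Finset (Fin n)) (c : Bool) (hinf : ¬ ∃ z : Fin n → Bool, parity C z = c ∧ ∀ j ∈ J, I.eval z j = y j)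
  {z : Fin n → Bool} (hz : ∀ j ∈ J, I.eval z j = y j)

include hI hT hinf hz

/-- **E1.**  An XOR-slot variable all of whose readers are constrained chords. -/
theorem endgame_all {g₁ : Fin m} (hg₁ : g₁ ∈ J) {s₁ : Fin 4} (hs₁ : s₁.val < 2)
    (hall : ∀ g ∈ J, I.vars g₁ s₁ ∈ varSet I g →
      (I.vars g 2 ∈ bdry I J ∧ I.vars g 3 ∈ bdry I J) ∧ (I.vars g 2 ∈ C ∨ I.vars g 3 ∈ C)) : False := by
  classical
  apply hinf
  refine repair I hI hT y J C c (Function.update z (I.vars g₁ s₁) (!z (I.vars g₁ s₁)))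
    (J.filter fun g => I.vars g₁ s₁ ∈ varSet I g) (filter_subset _ _)
    ⟨g₁, mem_filter.2 ⟨hg₁, vars_mem_varSet I g₁ s₁⟩⟩ (fun g hg => (hall g (mem_filter.1 hg).1 (mem_filter.1 hg).2).1)
    (fun g hg => (hall g (mem_filter.1 hg).1 (mem_filter.1 hg).2).2) (fun g hg => ?_) (fun j hj hjR => ?_)
  · obtain ⟨hgJ, hgu⟩ := mem_filter.1 hg
    obtain ⟨hch, hCg⟩ := hall g hgJ hgu
    obtain ⟨h2, h3⟩ := chord_true I hI hT y J C c hinf hz hgJ hch hCg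
    rw [xor_part_flip I hI z (xor_slot_of_mem I hT hs₁ hgu), xor_part_of_chord I hI (hz g hgJ) h2 h3, Bool.not_not]
  · have hu : I.vars g₁ s₁ ∉ varSet I j := fun h => hjR (mem_filter.2 ⟨hj, h⟩)
    rw [eval_update_of_not_mem I j z hu]
    exact hz j hj

/-- **E2.**  An XOR slot of an output with a private leaf and active partner, read otherwise only by constrained chords. -/
theorem endgame_leaf {f : Fin m} (hf : f ∈ J) {s₁ : Fin 4} (hs₁ : s₁.val < 2) {sp sq : Fin 4} (hsp : 2 ≤ sp.val)
    (hsq : 2 ≤ sq.val) (hpq : sp ≠ sq) (hleaf : I.vars f sp ∈ bdry I J) (hact : z (I.vars f sq) = true)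
    (hall : ∀ g ∈ J, g ≠ f → I.vars f s₁ ∈ varSet I g →
      (I.vars g 2 ∈ bdry I J ∧ I.vars g 3 ∈ bdry I J) ∧ (I.vars g 2 ∈ C ∨ I.vars g 3 ∈ C))
    (hex : ∃ g ∈ J, g ≠ f ∧ I.vars f s₁ ∈ varSet I g) : False := by
  classical
  apply hinf
  -- names
  have hup : I.vars f sp ≠ I.vars f s₁ := fun h => hT f f s₁ sp hs₁ hsp h.symm
  have huq : I.vars f sq ≠ I.vars f s₁ := fun h => hT f f s₁ sq hs₁ hsq h.symm
  have hleafpriv : ∀ g ∈ J, g ≠ f → I.vars f sp ∉ varSet I g := fun g hg hne =>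
    not_mem_varSet_of_private I hf hg hne hleaf (vars_mem_varSet I f sp)
  obtain ⟨z', hz'⟩ : ∃ z' : Fin n → Bool, z' = Function.update z (I.vars f s₁) (!z (I.vars f s₁)) := ⟨_, rfl⟩
  have hz'p : z' (I.vars f sp) = z (I.vars f sp) := by rw [hz', Function.update_of_ne hup]
  obtain ⟨g₂, hg₂J, hg₂f, hg₂u⟩ := hex
  refine repair I hI hT y J C c (Function.update z' (I.vars f sp) (!z' (I.vars f sp)))
    ((J.filter fun g => I.vars f s₁ ∈ varSet I g).erase f) ((erase_subset _ _).trans (filter_subset _ _))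
    ⟨g₂, mem_erase.2 ⟨hg₂f, mem_filter.2 ⟨hg₂J, hg₂u⟩⟩⟩ (fun g hg => ?_) (fun g hg => ?_) (fun g hg => ?_) (fun j hj hjR => ?_)
  · obtain ⟨hne, hg'⟩ := mem_erase.1 hg
    exact (hall g (mem_filter.1 hg').1 hne (mem_filter.1 hg').2).1
  · obtain ⟨hne, hg'⟩ := mem_erase.1 hg
    exact (hall g (mem_filter.1 hg').1 hne (mem_filter.1 hg').2).2
  · obtain ⟨hne, hg'⟩ := mem_erase.1 hg
    obtain ⟨hgJ, hgu⟩ := mem_filter.1 hg'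
    obtain ⟨hch, hCg⟩ := hall g hgJ hne hgu
    obtain ⟨h2, h3⟩ := chord_true I hI hT y J C c hinf hz hgJ hch hCg
    have hp0 : I.vars g 0 ≠ I.vars f sp := fun h => hleafpriv g hgJ hne (h ▸ vars_mem_varSet I g 0)
    have hp1 : I.vars g 1 ≠ I.vars f sp := fun h => hleafpriv g hgJ hne (h ▸ vars_mem_varSet I g 1)
    rw [Function.update_of_ne hp0, Function.update_of_ne hp1, hz',
      xor_part_flip I hI z (xor_slot_of_mem I hT hs₁ hgu), xor_part_of_chord I hI (hz g hgJ) h2 h3, Bool.not_not]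
  · by_cases hjf : j = f
    · subst hjf
      have hact' : z' (I.vars j sq) = true := by rw [hz', Function.update_of_ne huq]; exact hact
      rw [eval_update_and_slot I hI z' j sp sq hsp hsq hpq hact', hz', eval_update_xor_slot I hI z j s₁ hs₁, Bool.not_not]
      exact hz j hj
    · have hu : I.vars f s₁ ∉ varSet I j := fun h => hjR (mem_erase.2 ⟨hjf, mem_filter.2 ⟨hj, h⟩⟩)
      rw [eval_update_of_not_mem I j z' (hleafpriv j hj hjf), hz', eval_update_of_not_mem I j z hu]
      exact hz j hj

/-- **E3.**  Both XOR variables of `f` read otherwise only by constrained chords, none reading both. -/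
theorem endgame_double {f : Fin m} (hf : f ∈ J)
    (hall : ∀ g ∈ J, g ≠ f → (I.vars f 0 ∈ varSet I g ∨ I.vars f 1 ∈ varSet I g) →
      (I.vars g 2 ∈ bdry I J ∧ I.vars g 3 ∈ bdry I J) ∧ (I.vars g 2 ∈ C ∨ I.vars g 3 ∈ C))
    (hone : ∀ g ∈ J, g ≠ f → ¬ (I.vars f 0 ∈ varSet I g ∧ I.vars f 1 ∈ varSet I g))
    (hex : ∃ g ∈ J, g ≠ f ∧ (I.vars f 0 ∈ varSet I g ∨ I.vars f 1 ∈ varSet I g)) : False := by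
  classical
  apply hinf
  have h01 : I.vars f 0 ≠ I.vars f 1 := fun h => absurd (hI.2 f h) (by decide)
  obtain ⟨z', hz'⟩ : ∃ z' : Fin n → Bool, z' = Function.update z (I.vars f 0) (!z (I.vars f 0)) := ⟨_, rfl⟩
  have hz'v : z' (I.vars f 1) = z (I.vars f 1) := by rw [hz', Function.update_of_ne h01.symm]
  obtain ⟨g₂, hg₂J, hg₂f, hg₂u⟩ := hex
  refine repair I hI hT y J C c (Function.update z' (I.vars f 1) (!z' (I.vars f 1)))
    ((J.filter fun g => I.vars f 0 ∈ varSet I g ∨ I.vars f 1 ∈ varSet I g).erase f)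
    ((erase_subset _ _).trans (filter_subset _ _)) ⟨g₂, mem_erase.2 ⟨hg₂f, mem_filter.2 ⟨hg₂J, hg₂u⟩⟩⟩
    (fun g hg => ?_) (fun g hg => ?_) (fun g hg => ?_) (fun j hj hjR => ?_)
  · obtain ⟨hne, hg'⟩ := mem_erase.1 hg
    exact (hall g (mem_filter.1 hg').1 hne (mem_filter.1 hg').2).1
  · obtain ⟨hne, hg'⟩ := mem_erase.1 hg
    exact (hall g (mem_filter.1 hg').1 hne (mem_filter.1 hg').2).2
  · obtain ⟨hne, hg'⟩ := mem_erase.1 hg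
    obtain ⟨hgJ, hguv⟩ := mem_filter.1 hg'
    obtain ⟨hch, hCg⟩ := hall g hgJ hne hguv
    obtain ⟨h2, h3⟩ := chord_true I hI hT y J C c hinf hz hgJ hch hCg
    have hxz := xor_part_of_chord I hI (hz g hgJ) h2 h3
    rcases hguv with hgu | hgv
    · -- reads `u`, not `v`
      have hgv : I.vars f 1 ∉ varSet I g := fun h => hone g hgJ hne ⟨hgu, h⟩
      have hv0 : I.vars g 0 ≠ I.vars f 1 := fun h => hgv (h ▸ vars_mem_varSet I g 0)
      have hv1 : I.vars g 1 ≠ I.vars f 1 := fun h => hgv (h ▸ vars_mem_varSet I g 1)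
      rw [Function.update_of_ne hv0, Function.update_of_ne hv1, hz', xor_part_flip I hI z (xor_slot_of_mem I hT (s := 0)
        (by decide) hgu), hxz, Bool.not_not]
    · -- reads `v`, not `u`
      have hgu : I.vars f 0 ∉ varSet I g := fun h => hone g hgJ hne ⟨h, hgv⟩
      have hu0 : I.vars g 0 ≠ I.vars f 0 := fun h => hgu (h ▸ vars_mem_varSet I g 0)
      have hu1 : I.vars g 1 ≠ I.vars f 0 := fun h => hgu (h ▸ vars_mem_varSet I g 1)
      have e : ∀ w, w ≠ I.vars f 0 → Function.update z' (I.vars f 1) (!z' (I.vars f 1)) w =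
          Function.update z (I.vars f 1) (!z (I.vars f 1)) w := by
        intro w hw
        rw [hz'v]
        by_cases hwv : w = I.vars f 1
        · subst hwv; rw [Function.update_self, Function.update_self]
        · rw [Function.update_of_ne hwv, Function.update_of_ne hwv, hz', Function.update_of_ne hw]
      rw [e _ hu0, e _ hu1, xor_part_flip I hI z (xor_slot_of_mem I hT (s := 1) (by decide) hgv), hxz, Bool.not_not]
  · by_cases hjf : j = f
    · subst hjf
      rw [eval_update_xor_slot I hI z' j 1 (by decide), hz', eval_update_xor_slot I hI z j 0 (by decide), Bool.not_not]
      exact hz j hj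
    · have hju : I.vars f 0 ∉ varSet I j := fun h => hjR (mem_erase.2 ⟨hjf, mem_filter.2 ⟨hj, Or.inl h⟩⟩)
      have hjv : I.vars f 1 ∉ varSet I j := fun h => hjR (mem_erase.2 ⟨hjf, mem_filter.2 ⟨hj, Or.inr h⟩⟩)
      rw [eval_update_of_not_mem I j z' hjv, hz', eval_update_of_not_mem I j z hju]
      exact hz j hj

end Endgames

end Summit.PneNP.PneNP.Theorems.PstarGapOneAndEndgames
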